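import Literature.AlgebraicGeometry.Motives.AbelianVarietyHondaTate
import HarnessLib

/-!
# Honda–Tate for ORDINARY abelian varieties over a finite field (Howe 1995, Thm. 3.3), statement layer

Let `K = 𝔽_q`, `q` a power of the prime `p = ringChar K`, and for an abelian variety `A` over `K` let
`P_A ∈ ℤ[X]` (`h_A` in Howe's notation) be the characteristic polynomial of its Frobenius
(`AbelianVariety.IsFrobCharpoly A P`, file `AbelianVarietyHondaTate`).  The companion files record
Weil's Riemann hypothesis, the existence half of Honda–Tate (`hondaTateExistence`: every Weil
`q`-polynomial is a `P_A` UP TO A POWER) and Tate's theorem.  This file records the one published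
statement that removes the power for a named class of polynomials, in the POLYNOMIAL form in which
the source states it:

* `IsOrdinaryWeilPoly p q h` — Howe 1995 [Howe1995OrdinaryAV] (Trans. AMS 347, held:
  `paper:doi-10-1090-s0002-9947-1995-1297531-4`, read), Definition (3.2), p. 2366, verbatim: "Let `q` be
  a power of a prime number `p`. An ordinary Weil `q`-polynomial is a monic `h ∈ ℤ[X]` of even degree
  such that (a) all of the roots of `h` in `ℂ` have magnitude `q^{1/2}`, and (b) the middle coefficient
  of `h` is not divisible by `p`."  [(3.1): "The middle coefficient of a polynomial in `X` of degree
  `2g` is the coefficient of `X^g`."]  A DEFINITION on integer polynomials, recorded literally.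
* `AbelianVariety.hondaTateOrdinary K` — NAMED FACT (D-0014: `def … : Prop`, used as an explicit
  hypothesis `(hO : hondaTateOrdinary K)`, never asserted).  Howe 1995, p. 2366, verbatim: "we denote by
  `h_A` the characteristic polynomial in `ℤ[X]` of the Frobenius endomorphism of `A`. The degree of the
  polynomial `h_A` is twice the dimension of `A`"; Definition (3.1): "A `g`-dimensional abelian variety
  `A` over `k` is ordinary if the following equivalent conditions are satisfied: (a) `A` has exactly
  `p^g` points over `k̄` of order dividing `p`. […] (d) The middle coefficient of `h_A` is not divisible
  by `p`"; "From these definitions we see that if `A` is an ordinary abelian variety over `𝔽_q`, then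
  `h_A` is an ordinary Weil `q`-polynomial. In fact, all ordinary Weil `q`-polynomials arise in this
  way.  (3.3) THEOREM (Honda–Tate for ordinary varieties). Let `q` be a power of a prime number `p` and
  let `k` be a field with `q` elements. The map that sends an ordinary abelian variety `A` over `k` to
  the polynomial `h_A` induces a bijection between the set of isogeny classes of ordinary abelian
  varieties over `k` and the set of ordinary Weil `q`-polynomials. Under this bijection, isogeny classes
  of simple ordinary abelian varieties correspond to irreducible ordinary Weil `q`-polynomials.  Proof.
  This theorem follows easily from the standard Honda–Tate theorem ([19, Théorème 1, p. 96]) and from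
  the fact that for a simple ordinary abelian variety `A` the polynomial `h_A` is irreducible."
  POLYNOMIAL FORM recorded (the SURJECTIVITY clause only): every ordinary Weil `q`-polynomial of
  positive degree, `q = #K`, `p = ringChar K`, is the characteristic polynomial of the Frobenius of an
  abelian variety over `K` — with exponent `1`, in contrast to `hondaTateExistence`.  (The degree-`0`
  polynomial `1`, formally ordinary, corresponds to the zero variety and is excluded.)  Consistent
  accounts: Waterhouse 1969 [Waterhouse1969], Prop. 7.1 and Thm. 7.2 (p. 553: for ordinary elementary
  `A`, "End `A` is commutative", so `e = [E:ℚ(π)]^{1/2} = 1`); Dupuy–Kedlaya–Roe–Vincent 2021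
  [DupuyKedlayaRoeVincent2021LMFDB], § 2.3 (p. 6: "`e_A = 1` whenever `A` is ordinary or 'almost
  ordinary'").  Not proved in the tree (it is Honda–Tate plus the computation of the local invariants of
  `End⁰ A` in the ordinary case); used as the hypothesis `(hO : AbelianVariety.hondaTateOrdinary K)`.

## What is PROVED here (no further input)

Projections of the definition (`IsOrdinaryWeilPoly.monic`, `.rh`, `.exists_half_degree`), the
reformulation `isOrdinaryWeilPoly_iff_coeff_half` (the middle coefficient is `h.coeff (h.natDegree / 2)`),
and `not_isOrdinaryWeilPoly_of_dvd_coeff_half` (a polynomial whose middle coefficient is divisible by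
`p` is not ordinary).

## Deliberately NOT here

Howe's injectivity clause (isogeny classes, needs `IsIsogenous` over a finite field) and the
simple ↔ irreducible clause; Definition (3.1) (a)–(c) (the `p`-divisible group, `p`-adic roots) and the
equivalence (a)⇔(d) (Deligne 1969, § 2); Prop. (3.4) (an ordinary Weil `q`-polynomial satisfies
`a_0 = q^g` and `X^{2g} h(q/X) = q^g h(X)`); Deligne's equivalence of categories (§ 4).  No `_holds`
theorem: the fact rests on Honda–Tate (`hondaTateExistence` is itself a named fact).

## References

* [Howe1995OrdinaryAV] E. W. Howe, *Principally polarized ordinary abelian varieties over finite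
  fields*, Trans. Amer. Math. Soc. 347 (1995), 2361–2401: § 3, Definitions (3.1), (3.2) and Theorem
  (3.3), p. 2366.  Held, read.
* [Waterhouse1969] W. C. Waterhouse, *Abelian varieties over finite fields*, Ann. sci. ÉNS (4) 2
  (1969): p. 526 (definition of ordinary), Prop. 7.1 and Thm. 7.2, p. 553.  Held, read.
* [DupuyKedlayaRoeVincent2021LMFDB] T. Dupuy, K. Kedlaya, D. Roe, C. Vincent, *Isogeny classes of
  abelian varieties over finite fields in the LMFDB* (2021), § 2.3–2.4, p. 6.  Held, read.
* [Tate1971HondaBourbaki] J. Tate, Sém. Bourbaki 352, Th. 1, p. 96 (Howe's reference [19]).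
-/

open Polynomial

universe u

namespace Literature.AlgebraicGeometry.Motives

/-! ## Ordinary Weil `q`-polynomials (Howe 1995, Definition (3.2)) -/

/-- **Ordinary Weil `q`-polynomial** (Howe 1995, Definition (3.2), p. 2366, verbatim: "Let `q` be a
power of a prime number `p`. An ordinary Weil `q`-polynomial is a monic `h ∈ ℤ[X]` of even degree such
that (a) all of the roots of `h` in `ℂ` have magnitude `q^{1/2}`, and (b) the middle coefficient of `h`
is not divisible by `p`", the middle coefficient of a polynomial of degree `2g` being "the coefficient
of `X^g`" (Definition (3.1))).  Recorded literally, for arbitrary naturals `p`, `q` (the source takes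
`q` a power of the prime `p`; the named fact below instantiates `p = ringChar K`, `q = #K`).
[cite: Howe1995OrdinaryAV, Definition (3.2), p. 2366] -/
def IsOrdinaryWeilPoly (p q : ℕ) (h : ℤ[X]) : Prop :=
  h.Monic ∧ (∃ g : ℕ, h.natDegree = 2 * g ∧ ¬ ((p : ℤ) ∣ h.coeff g)) ∧
    ∀ α ∈ (h.map (Int.castRingHom ℂ)).roots, ‖α‖ = Real.sqrt q

namespace IsOrdinaryWeilPoly

variable {p q : ℕ} {h : ℤ[X]}

/-- An ordinary Weil `q`-polynomial is monic (clause of Definition (3.2)).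
[cite: Howe1995OrdinaryAV, Definition (3.2), p. 2366] -/
theorem monic (hh : IsOrdinaryWeilPoly p q h) : h.Monic := hh.1

/-- An ordinary Weil `q`-polynomial has all complex roots of absolute value `q^{1/2}` (clause (a)).
[cite: Howe1995OrdinaryAV, Definition (3.2) (a), p. 2366] -/
theorem rh (hh : IsOrdinaryWeilPoly p q h) :
    ∀ α ∈ (h.map (Int.castRingHom ℂ)).roots, ‖α‖ = Real.sqrt q := hh.2.2

/-- An ordinary Weil `q`-polynomial has even degree `2g` and middle coefficient prime to `p`
(clause (b)). [cite: Howe1995OrdinaryAV, Definition (3.2) (b), p. 2366] -/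
theorem exists_half_degree (hh : IsOrdinaryWeilPoly p q h) :
    ∃ g : ℕ, h.natDegree = 2 * g ∧ ¬ ((p : ℤ) ∣ h.coeff g) := hh.2.1

/-- The middle coefficient of an ordinary Weil `q`-polynomial, written as `h.coeff (h.natDegree / 2)`,
is not divisible by `p`. [cite: Howe1995OrdinaryAV, Definition (3.2) (b), p. 2366] -/
theorem not_dvd_coeff_half (hh : IsOrdinaryWeilPoly p q h) :
    ¬ ((p : ℤ) ∣ h.coeff (h.natDegree / 2)) := by
  obtain ⟨g, hg, hng⟩ := hh.exists_half_degree
  rwa [hg, Nat.mul_div_cancel_left g (by norm_num : 0 < 2)]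

end IsOrdinaryWeilPoly

/-- Definition (3.2) with the middle coefficient written as `h.coeff (h.natDegree / 2)`:
`h` is an ordinary Weil `q`-polynomial iff it is monic of even degree, its coefficient of
`X^{deg h / 2}` is prime to `p`, and all its complex roots have absolute value `q^{1/2}`.
[cite: Howe1995OrdinaryAV, Definitions (3.1)–(3.2), p. 2366] -/
theorem isOrdinaryWeilPoly_iff_coeff_half {p q : ℕ} {h : ℤ[X]} :
    IsOrdinaryWeilPoly p q h ↔
      h.Monic ∧ Even h.natDegree ∧ ¬ ((p : ℤ) ∣ h.coeff (h.natDegree / 2)) ∧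
        ∀ α ∈ (h.map (Int.castRingHom ℂ)).roots, ‖α‖ = Real.sqrt q := by
  constructor
  · intro hh
    obtain ⟨g, hg, _⟩ := hh.exists_half_degree
    exact ⟨hh.monic, ⟨g, by rw [hg]; ring⟩, hh.not_dvd_coeff_half, hh.rh⟩
  · rintro ⟨hm, ⟨g, hg⟩, hc, hr⟩
    refine ⟨hm, ⟨g, by rw [hg]; ring, ?_⟩, hr⟩
    rwa [hg, show g + g = 2 * g by ring, Nat.mul_div_cancel_left g (by norm_num : 0 < 2)] at hc

/-- A polynomial whose middle coefficient `h.coeff (h.natDegree / 2)` is divisible by `p` is not an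
ordinary Weil `q`-polynomial. [cite: Howe1995OrdinaryAV, Definition (3.2) (b), p. 2366] -/
theorem not_isOrdinaryWeilPoly_of_dvd_coeff_half {p q : ℕ} {h : ℤ[X]}
    (hdvd : (p : ℤ) ∣ h.coeff (h.natDegree / 2)) : ¬ IsOrdinaryWeilPoly p q h :=
  fun hh => hh.not_dvd_coeff_half hdvd

namespace AbelianVariety

variable {K : Type u} [Field K] [Finite K]

variable (K) in
/-- **NAMED FACT — Honda–Tate for ordinary abelian varieties, surjectivity, polynomial form**
(Howe 1995, Theorem (3.3), p. 2366, verbatim: "Let `q` be a power of a prime number `p` and let `k` be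
a field with `q` elements. The map that sends an ordinary abelian variety `A` over `k` to the
polynomial `h_A` induces a bijection between the set of isogeny classes of ordinary abelian varieties
over `k` and the set of ordinary Weil `q`-polynomials. Under this bijection, isogeny classes of simple
ordinary abelian varieties correspond to irreducible ordinary Weil `q`-polynomials", where (p. 2366)
"we denote by `h_A` the characteristic polynomial in `ℤ[X]` of the Frobenius endomorphism of `A`. The
degree of the polynomial `h_A` is twice the dimension of `A`", and "if `A` is an ordinary abelian
variety over `𝔽_q`, then `h_A` is an ordinary Weil `q`-polynomial. In fact, all ordinary Weil
`q`-polynomials arise in this way"; Definition (3.1) (d): `A` is ordinary iff "the middle coefficient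
of `h_A` is not divisible by `p`").  POLYNOMIAL FORM recorded (surjectivity clause only): every
ordinary Weil `q`-polynomial (`IsOrdinaryWeilPoly (ringChar K) (Nat.card K)`) of positive degree is
the characteristic polynomial of the Frobenius of an abelian variety over `K` — exponent ONE, in
contrast to `hondaTateExistence` (a power).  The degree-`0` case (`h = 1`, the zero variety) is
excluded.  Consistent: Waterhouse 1969, Prop. 7.1 / Thm. 7.2, p. 553 (End `A` commutative for ordinary
elementary `A`, whence `e = 1`); Dupuy–Kedlaya–Roe–Vincent 2021, § 2.3, p. 6 ("`e_A = 1` whenever `A`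
is ordinary").  Not proved in the tree (Honda–Tate plus the local invariants of `End⁰ A` in the
ordinary case); used as the hypothesis `(hO : AbelianVariety.hondaTateOrdinary K)`.
[cite: Howe1995OrdinaryAV, Theorem (3.3) and Definitions (3.1) (d), (3.2), p. 2366]
[cite: Waterhouse1969, Prop. 7.1 and Thm. 7.2 (p. 553)]
[cite: DupuyKedlayaRoeVincent2021LMFDB, § 2.3 (p. 6)] -/
def hondaTateOrdinary : Prop :=
  ∀ h : ℤ[X], IsOrdinaryWeilPoly (ringChar K) (Nat.card K) h → 0 < h.natDegree →
    ∃ A : AbelianVariety K, A.IsFrobCharpoly h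

end AbelianVariety

end Literature.AlgebraicGeometry.Motives
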